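import Mathlib
import HarnessLib
import Literature.Analysis.Fourier.TorusFourierTailSmooth
import Literature.Analysis.Fourier.TorusGridAliasingTail
import Literature.Analysis.Fourier.TorusDescendCalculus
import Literature.Analysis.FunctionSpaces.TorusSobolevNormFacts
import Summits.HubbardSuperconductivity.HubbardSuperconductivity.Theorems.KLProgrammeC4aSymbolCosSeries

/-!
# Route `KLProgramme` — crux C4a / stub (C) «(C)-B-REP» sup route, (R59bl) part 2: THE GENERIC ALIASING-JET LEMMA for lattice data `(g·P)∘p`
# (smooth `g` × trigonometric polynomial `P` RESOLVED by the grid): the Fourier coefficients of `(g·P)♭` and the `ℤ²` TAIL BOUND `≤ M_j(P̌)·G_j(ĝ; L/4)`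

Cell `gate-hubbard-kl`, lane hubbard-kl-c4a-1 (g4); pen (R59bl) (KL STATUS l.3734), p2 g13 spec HOME/p2-g13/SUP-ROUTE-SPEC-p2g13.md §2.  Consumer: p2's
assembly `…EngineFrameShiftDressingSup` (the tree/dressing jets `A, A′, A_J` of the corrected (B) door are pure aliasing: `g ∈ {d_ext, J₁, J₂}` vanishes near the
curve point `q`, so `Dʲ(g·P)(q) = 0` and only the tail survives).

Setting.  `g : Momentum → ℝ` smooth and `2π`-periodic; `P(q) = Σ_{x ∈ B} c_x cos(x·q)`, `B ⊂ ℤ²` finite with `4|xᵢ| ≤ L` (RESOLVED: `|x|_∞ ≤ L/4`);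
`F = g·P` (assumed `D₄`-symmetric, as the consumer's data are).  With the flat symbols `F♭, g♭` of part 1 (`…C4aSymbolCosSeries.symbolFlat`):

* §1 `symbolFlat_mul_trigPoly_apply` — `F♭ = ½(Σ_x c_x e_x + Σ_x c_x e_{−x})·g♭`; `mFourierCoeff_symbolFlat_mul_trigPoly` —
  `𝓕F♭(ν) = Σ_{x∈B} (c_x/2)(ĝ♭(ν − x) + ĝ♭(ν + x))` (g2's `mFourierCoeff_trigPoly_mul`); `norm_mFourierCoeff_symbolFlat_mul_trigPoly_le`;
* §2 **`ztail_symbolFlat_mul_trigPoly_le`** — the `ℤ²` tail of part 1 for the product: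
  `Σ'_ν [L/2 < |ν₀| ∨ L/2 < |ν₁|] ‖𝓕F♭(ν)‖(|ν₀|+|ν₁|)ʲ ≤ M_j · G_j`, `M_j = Σ_{x∈B} |c_x|(1+|x₀|+|x₁|)ʲ`,
  `G_j = Σ'_η [∃ i, L/4 < |ηᵢ|] ‖ĝ♭(η)‖(1+|η₀|+|η₁|)ʲ` (shift by a resolved frequency keeps the half-tail inside the quarter-tail; `|ν|₁ ≤ |x|₁ + |η|₁`);
  weighted summability of `𝓕F♭` from that of `ĝ♭` (`summable_weighted_symbolFlat_mul_trigPoly`);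
(The assembled generic lemma `norm_iteratedFDeriv_evalM_symInterp_mul_trigPoly_le` and the quarter-tail bound from `‖∂^M g♭‖` are part 3,
`…C4aAliasingJetLemma`.)

Pure harmonic analysis; nothing is asserted about the Hubbard model.  References: Boyd 2001 §4.5 Thm 19–20 [cite: Boyd2001]; Grafakos 2014 §3.3.3 [cite: Grafakos2014].
-/

noncomputable section

namespace Summit.HubbardSuperconductivity.HubbardSuperconductivity.Theorems.C4a

set_option linter.dupNamespace false -- summit = problem name (single-conjunct summit), D-0017

open Real Set MeasureTheory UnitAddTorus Finset
open Literature.Probability.LatticeModels Literature.MathematicalPhysics.QuantumLattice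
open Literature.Analysis.Fourier Literature.Analysis.FunctionSpaces
open Summit.HubbardSuperconductivity.HubbardSuperconductivity.Theorems.KLRegimeSplit

/-! ## §1 The flat symbol of `g·P` and its Fourier coefficients -/

section Product

variable {g : Momentum → ℝ} (hgper : ∀ (j : Fin 2) (q : Momentum), g (q + EuclideanSpace.single j (2 * π)) = g q)
  (hg : ContDiff ℝ (⊤ : ℕ∞) g) (B : Finset (Fin 2 → ℤ)) (c : (Fin 2 → ℤ) → ℝ) {P : Momentum → ℝ}
  (hP : ∀ q : Momentum, P q = ∑ x ∈ B, c x * Real.cos (∑ i : Fin 2, (x i : ℝ) * q i))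
  (hFper : ∀ (j : Fin 2) (q : Momentum), (fun q => g q * P q) (q + EuclideanSpace.single j (2 * π)) = (fun q => g q * P q) q)

/-- The plane wave at the representative of a torus point is the character: `exp(2πi x·repr t) = e_x(t)`. -/
theorem cexp_planeWave_repr (x : Fin 2 → ℤ) (t : UnitAddTorus (Fin 2)) :
    Complex.exp (2 * Real.pi * Complex.I * (∑ i, (x i : ℝ) * (Literature.Analysis.FunctionSpaces.Torus.repr t) i : ℝ)) = mFourier x t := by
  have hx := congrFun (descend_planeWave (d := Fin 2) x) t
  rw [Literature.Analysis.FunctionSpaces.Torus.descend_apply] at hx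
  exact hx

/-- **`cos` of a resolved phase at the representative is the symmetrised character**:
`cos(Σᵢ xᵢ·(2π·repr t)ᵢ) = (e_x(t) + e_{−x}(t))/2` (complex form). -/
theorem ofReal_cos_phase_eq (x : Fin 2 → ℤ) (t : UnitAddTorus (Fin 2)) :
    ((Real.cos (∑ i : Fin 2, (x i : ℝ) * ((2 * π) • (Literature.Analysis.FunctionSpaces.Torus.repr t : Momentum)) i) : ℝ) : ℂ) =
      (mFourier x t + mFourier (-x) t) / 2 := by
  set y : Momentum := Literature.Analysis.FunctionSpaces.Torus.repr t with hy
  set θ : ℝ := ∑ i : Fin 2, (x i : ℝ) * ((2 * π) • y) i with hθ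
  have e1 : Complex.exp ((θ : ℂ) * Complex.I) = mFourier x t := by
    rw [← cexp_planeWave_repr x t, hθ]
    congr 1
    simp only [PiLp.smul_apply, smul_eq_mul]
    push_cast
    rw [Finset.sum_mul, Finset.mul_sum]
    exact Finset.sum_congr rfl fun i _ => by ring
  have e2 : Complex.exp (-(θ : ℂ) * Complex.I) = mFourier (-x) t := by
    rw [← cexp_planeWave_repr (-x) t, hθ]
    congr 1
    simp only [PiLp.smul_apply, smul_eq_mul, Pi.neg_apply, Int.cast_neg, neg_mul]
    push_cast
    rw [← neg_mul, ← Finset.sum_neg_distrib, Finset.sum_mul, Finset.mul_sum]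
    exact Finset.sum_congr rfl fun i _ => by ring
  rw [Complex.ofReal_cos, Complex.cos, e1, e2]

include hP in
/-- **The flat symbol of the product**: `(g·P)♭(t) = (Σ_{x∈B} (c_x/2)(e_x(t) + e_{−x}(t)))·g♭(t)`. -/
theorem symbolFlat_mul_trigPoly_apply (t : UnitAddTorus (Fin 2)) :
    symbolFlat (fun q => g q * P q) hFper t =
      (∑ x ∈ B, ((c x : ℂ) / 2) * (mFourier x t + mFourier (-x) t)) * symbolFlat g hgper t := by
  rw [symbolFlat, symbolFlat, Literature.Analysis.FunctionSpaces.Torus.descend_apply, Literature.Analysis.FunctionSpaces.Torus.descend_apply]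
  rw [hP, Complex.ofReal_mul, mul_comm, Complex.ofReal_sum]
  congr 1
  refine Finset.sum_congr rfl fun x _ => ?_
  rw [Complex.ofReal_mul, ofReal_cos_phase_eq]
  ring

include hP in
/-- The same as an identity of functions, in `mFourierCoeff_trigPoly_mul`'s shape: `F♭ = ½·[(Σ_x c_x e_x)·g♭] + ½·[(Σ_{y ∈ −B} c_{−y} e_y)·g♭]`. -/
theorem symbolFlat_mul_trigPoly_eq :
    symbolFlat (fun q => g q * P q) hFper =
      (1 / 2 : ℂ) • (fun t => (∑ x ∈ B, (c x : ℂ) * mFourier x t) * symbolFlat g hgper t) +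
        (1 / 2 : ℂ) • (fun t => (∑ y ∈ B.image (fun x => -x), (c (-y) : ℂ) * mFourier y t) * symbolFlat g hgper t) := by
  funext t
  rw [symbolFlat_mul_trigPoly_apply hgper B c hP hFper t]
  simp only [Pi.add_apply, Pi.smul_apply, smul_eq_mul]
  rw [Finset.sum_image (fun x _ y _ h => neg_injective h)]
  simp only [neg_neg, Finset.sum_mul, Finset.mul_sum]
  rw [← Finset.sum_add_distrib]
  refine Finset.sum_congr rfl fun x _ => ?_
  ring

include hP hg in
/-- **Fourier coefficients of the product**: `𝓕(g·P)♭(ν) = Σ_{x∈B} (c_x/2)·(ĝ♭(ν − x) + ĝ♭(ν + x))`. -/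
theorem mFourierCoeff_symbolFlat_mul_trigPoly (ν : Fin 2 → ℤ) :
    mFourierCoeff (symbolFlat (fun q => g q * P q) hFper) ν =
      ∑ x ∈ B, ((c x : ℂ) / 2) * (mFourierCoeff (symbolFlat g hgper) (ν - x) + mFourierCoeff (symbolFlat g hgper) (ν + x)) := by
  set gC : C(UnitAddTorus (Fin 2), ℂ) := ⟨symbolFlat g hgper, continuous_symbolFlat hgper hg.continuous⟩ with hgC
  have hcont : ∀ (S : Finset (Fin 2 → ℤ)) (a : (Fin 2 → ℤ) → ℂ),
      Continuous fun t : UnitAddTorus (Fin 2) => (∑ x ∈ S, a x * mFourier x t) * symbolFlat g hgper t := fun S a =>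
    (continuous_finsetSum S fun x _ => continuous_const.mul (mFourier x).continuous).mul (continuous_symbolFlat hgper hg.continuous)
  rw [symbolFlat_mul_trigPoly_eq hgper B c hP hFper,
    Torus.mFourierCoeff_add (((hcont _ _).integrable_unitAddTorus).smul _) (((hcont _ _).integrable_unitAddTorus).smul _),
    Torus.mFourierCoeff_const_smul, Torus.mFourierCoeff_const_smul]
  have h1 := mFourierCoeff_trigPoly_mul gC B (fun x => (c x : ℂ)) ν
  have h2 := mFourierCoeff_trigPoly_mul gC (B.image fun x => -x) (fun y => (c (-y) : ℂ)) ν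
  have e1 : (fun t : UnitAddTorus (Fin 2) => (∑ x ∈ B, (c x : ℂ) * mFourier x t) * symbolFlat g hgper t) =
      fun t => (∑ y ∈ B, (fun x => (c x : ℂ)) y * mFourier y t) * gC t := rfl
  have e2 : (fun t : UnitAddTorus (Fin 2) => (∑ y ∈ B.image (fun x => -x), (c (-y) : ℂ) * mFourier y t) * symbolFlat g hgper t) =
      fun t => (∑ y ∈ B.image (fun x => -x), (fun y => (c (-y) : ℂ)) y * mFourier y t) * gC t := rfl
  rw [e1, e2, h1, h2, Finset.sum_image (fun x _ y _ h => neg_injective h)]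
  simp only [neg_neg, smul_eq_mul, Finset.mul_sum, sub_neg_eq_add]
  rw [← Finset.sum_add_distrib]
  refine Finset.sum_congr rfl fun x _ => ?_
  show 1 / 2 * ((c x : ℂ) * mFourierCoeff (symbolFlat g hgper) (ν - x)) + 1 / 2 * ((c x : ℂ) * mFourierCoeff (symbolFlat g hgper) (ν + x)) = _
  ring

include hP hg in
/-- Norm bound: `‖𝓕(g·P)♭(ν)‖ ≤ Σ_{x∈B} (|c_x|/2)·(‖ĝ♭(ν − x)‖ + ‖ĝ♭(ν + x)‖)`. -/
theorem norm_mFourierCoeff_symbolFlat_mul_trigPoly_le (ν : Fin 2 → ℤ) :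
    ‖mFourierCoeff (symbolFlat (fun q => g q * P q) hFper) ν‖ ≤
      ∑ x ∈ B, (|c x| / 2) * (‖mFourierCoeff (symbolFlat g hgper) (ν - x)‖ + ‖mFourierCoeff (symbolFlat g hgper) (ν + x)‖) := by
  rw [mFourierCoeff_symbolFlat_mul_trigPoly hgper hg B c hP hFper ν]
  refine (norm_sum_le _ _).trans (Finset.sum_le_sum fun x _ => ?_)
  rw [norm_mul, norm_div, Complex.norm_real, Real.norm_eq_abs, Complex.norm_two]
  exact mul_le_mul_of_nonneg_left (norm_add_le _ _) (by positivity)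

end Product

/-! ## §2 The `ℤ²` tail of the product: shift by a resolved frequency -/

/-- **Resolved shift keeps the half-tail inside the quarter-tail**: `L/2 < |νᵢ|` and `4|xᵢ| ≤ L` give `L/4 < |νᵢ − xᵢ|`. -/
theorem quarter_lt_natAbs_sub {L : ℕ} {ν x : ℤ} (hν : L / 2 < ν.natAbs) (hx : 4 * |x| ≤ (L : ℤ)) : L / 4 < (ν - x).natAbs := by
  have h1 : ((L / 2 : ℕ) : ℤ) < |ν| := by
    have := Int.natCast_natAbs ν; zify at hν; omega
  have h2 : |ν| - |x| ≤ |ν - x| := abs_sub_abs_le_abs_sub ν x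
  have h3 : ((L / 4 : ℕ) : ℤ) < |ν - x| := by omega
  have := Int.natCast_natAbs (ν - x); zify; omega

/-- The same for `ν + x`. -/
theorem quarter_lt_natAbs_add {L : ℕ} {ν x : ℤ} (hν : L / 2 < ν.natAbs) (hx : 4 * |x| ≤ (L : ℤ)) : L / 4 < (ν + x).natAbs := by
  have h := quarter_lt_natAbs_sub (x := -x) hν (by rwa [abs_neg])
  rwa [sub_neg_eq_add] at h

/-- `ℓ¹` weight under a shift: `(|ν₀| + |ν₁|)ʲ ≤ (1 + |x₀| + |x₁|)ʲ·(1 + |η₀| + |η₁|)ʲ` for `ν = η + x` (or `η − (−x)`). -/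
theorem weight_shift_le (η x : Fin 2 → ℤ) (j : ℕ) :
    (|(((η + x) 0 : ℤ) : ℝ)| + |(((η + x) 1 : ℤ) : ℝ)|) ^ j ≤
      (1 + |((x 0 : ℤ) : ℝ)| + |((x 1 : ℤ) : ℝ)|) ^ j * (1 + ∑ i : Fin 2, |((η i : ℤ) : ℝ)|) ^ j := by
  rw [← mul_pow, Fin.sum_univ_two]
  refine pow_le_pow_left₀ (by positivity) ?_ j
  simp only [Pi.add_apply, Int.cast_add]
  have h0 := abs_add_le ((η 0 : ℤ) : ℝ) ((x 0 : ℤ) : ℝ)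
  have h1 := abs_add_le ((η 1 : ℤ) : ℝ) ((x 1 : ℤ) : ℝ)
  nlinarith [abs_nonneg ((η 0 : ℤ) : ℝ), abs_nonneg ((η 1 : ℤ) : ℝ), abs_nonneg ((x 0 : ℤ) : ℝ), abs_nonneg ((x 1 : ℤ) : ℝ),
    mul_nonneg (add_nonneg (abs_nonneg ((x 0 : ℤ) : ℝ)) (abs_nonneg ((x 1 : ℤ) : ℝ)))
      (add_nonneg (abs_nonneg ((η 0 : ℤ) : ℝ)) (abs_nonneg ((η 1 : ℤ) : ℝ)))]

/-- **`g·P` is `2π`-periodic** when `g` is (the frequencies of `P` are integral). -/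
theorem mul_trigPoly_periodic {g : Momentum → ℝ} (hgper : ∀ (j : Fin 2) (q : Momentum), g (q + EuclideanSpace.single j (2 * π)) = g q)
    (B : Finset (Fin 2 → ℤ)) (c : (Fin 2 → ℤ) → ℝ) {P : Momentum → ℝ}
    (hP : ∀ q : Momentum, P q = ∑ x ∈ B, c x * Real.cos (∑ i : Fin 2, (x i : ℝ) * q i)) (j : Fin 2) (q : Momentum) :
    (fun q => g q * P q) (q + EuclideanSpace.single j (2 * π)) = (fun q => g q * P q) q := by
  simp only [hgper, hP]
  congr 1
  refine Finset.sum_congr rfl fun x _ => ?_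
  congr 1
  have hsum : ∑ i : Fin 2, (x i : ℝ) * (q + EuclideanSpace.single j (2 * π)) i = (∑ i : Fin 2, (x i : ℝ) * q i) + (x j : ℤ) * (2 * π) := by
    simp only [PiLp.add_apply, PiLp.single_apply, mul_add, Finset.sum_add_distrib, mul_ite, mul_zero, Finset.sum_ite_eq',
      Finset.mem_univ, if_true]
  rw [hsum, Real.cos_add_int_mul_two_pi]

section Tail

variable {L : ℕ} {g : Momentum → ℝ} (hgper : ∀ (j : Fin 2) (q : Momentum), g (q + EuclideanSpace.single j (2 * π)) = g q)
  (hg : ContDiff ℝ (⊤ : ℕ∞) g) (B : Finset (Fin 2 → ℤ)) (c : (Fin 2 → ℤ) → ℝ) (hB : ∀ x ∈ B, ∀ i, 4 * |x i| ≤ (L : ℤ))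
  {P : Momentum → ℝ} (hP : ∀ q : Momentum, P q = ∑ x ∈ B, c x * Real.cos (∑ i : Fin 2, (x i : ℝ) * q i))
include hg hB hP

omit hg hP in
/-- The shifted quarter-tail majorant (difference): for `x ∈ B` and a half-tail frequency `ν`,
`‖ĝ♭(ν − x)‖·(|ν₀|+|ν₁|)ʲ ≤ (1+|x₀|+|x₁|)ʲ · G(ν − x)` with `G(η) = [∃ i, L/4 < |ηᵢ|]·‖ĝ♭(η)‖(1 + Σ|ηᵢ|)ʲ`. -/
theorem shifted_term_sub_le {x : Fin 2 → ℤ} (hx : x ∈ B) {ν : Fin 2 → ℤ} (hν : L / 2 < (ν 0).natAbs ∨ L / 2 < (ν 1).natAbs) (j : ℕ) :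
    ‖mFourierCoeff (symbolFlat g hgper) (ν - x)‖ * (|((ν 0 : ℤ) : ℝ)| + |((ν 1 : ℤ) : ℝ)|) ^ j ≤
      (1 + |((x 0 : ℤ) : ℝ)| + |((x 1 : ℤ) : ℝ)|) ^ j *
        (if ∃ i, L / 4 < ((ν - x) i).natAbs then
          ‖mFourierCoeff (symbolFlat g hgper) (ν - x)‖ * (1 + ∑ i : Fin 2, |(((ν - x) i : ℤ) : ℝ)|) ^ j else 0) := by
  have htail : ∃ i, L / 4 < ((ν - x) i).natAbs := by
    rcases hν with h | h
    · exact ⟨0, quarter_lt_natAbs_sub h (hB x hx 0)⟩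
    · exact ⟨1, quarter_lt_natAbs_sub h (hB x hx 1)⟩
  rw [if_pos htail]
  have hw : (|((ν 0 : ℤ) : ℝ)| + |((ν 1 : ℤ) : ℝ)|) ^ j ≤
      (1 + |((x 0 : ℤ) : ℝ)| + |((x 1 : ℤ) : ℝ)|) ^ j * (1 + ∑ i : Fin 2, |(((ν - x) i : ℤ) : ℝ)|) ^ j := by
    have key := weight_shift_le (ν - x) x j
    rwa [sub_add_cancel] at key
  calc ‖mFourierCoeff (symbolFlat g hgper) (ν - x)‖ * (|((ν 0 : ℤ) : ℝ)| + |((ν 1 : ℤ) : ℝ)|) ^ j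
      ≤ ‖mFourierCoeff (symbolFlat g hgper) (ν - x)‖ *
          ((1 + |((x 0 : ℤ) : ℝ)| + |((x 1 : ℤ) : ℝ)|) ^ j * (1 + ∑ i : Fin 2, |(((ν - x) i : ℤ) : ℝ)|) ^ j) :=
        mul_le_mul_of_nonneg_left hw (norm_nonneg _)
    _ = _ := by ring

omit hg hP in
/-- The shifted quarter-tail majorant (sum): `‖ĝ♭(ν + x)‖·(|ν₀|+|ν₁|)ʲ ≤ (1+|x₀|+|x₁|)ʲ · G(ν + x)`. -/
theorem shifted_term_add_le {x : Fin 2 → ℤ} (hx : x ∈ B) {ν : Fin 2 → ℤ} (hν : L / 2 < (ν 0).natAbs ∨ L / 2 < (ν 1).natAbs) (j : ℕ) :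
    ‖mFourierCoeff (symbolFlat g hgper) (ν + x)‖ * (|((ν 0 : ℤ) : ℝ)| + |((ν 1 : ℤ) : ℝ)|) ^ j ≤
      (1 + |((x 0 : ℤ) : ℝ)| + |((x 1 : ℤ) : ℝ)|) ^ j *
        (if ∃ i, L / 4 < ((ν + x) i).natAbs then
          ‖mFourierCoeff (symbolFlat g hgper) (ν + x)‖ * (1 + ∑ i : Fin 2, |(((ν + x) i : ℤ) : ℝ)|) ^ j else 0) := by
  have htail : ∃ i, L / 4 < ((ν + x) i).natAbs := by
    rcases hν with h | h
    · exact ⟨0, quarter_lt_natAbs_add h (hB x hx 0)⟩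
    · exact ⟨1, quarter_lt_natAbs_add h (hB x hx 1)⟩
  rw [if_pos htail]
  have hw : (|((ν 0 : ℤ) : ℝ)| + |((ν 1 : ℤ) : ℝ)|) ^ j ≤
      (1 + |((x 0 : ℤ) : ℝ)| + |((x 1 : ℤ) : ℝ)|) ^ j * (1 + ∑ i : Fin 2, |(((ν + x) i : ℤ) : ℝ)|) ^ j := by
    have key := weight_shift_le (ν + x) (-x) j
    rw [add_neg_cancel_right] at key
    have h0 : |(((-x) 0 : ℤ) : ℝ)| = |((x 0 : ℤ) : ℝ)| := by rw [Pi.neg_apply, Int.cast_neg, abs_neg]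
    have h1 : |(((-x) 1 : ℤ) : ℝ)| = |((x 1 : ℤ) : ℝ)| := by rw [Pi.neg_apply, Int.cast_neg, abs_neg]
    rwa [h0, h1] at key
  calc ‖mFourierCoeff (symbolFlat g hgper) (ν + x)‖ * (|((ν 0 : ℤ) : ℝ)| + |((ν 1 : ℤ) : ℝ)|) ^ j
      ≤ ‖mFourierCoeff (symbolFlat g hgper) (ν + x)‖ *
          ((1 + |((x 0 : ℤ) : ℝ)| + |((x 1 : ℤ) : ℝ)|) ^ j * (1 + ∑ i : Fin 2, |(((ν + x) i : ℤ) : ℝ)|) ^ j) :=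
        mul_le_mul_of_nonneg_left hw (norm_nonneg _)
    _ = _ := by ring

/-- **THE `ℤ²` TAIL OF THE PRODUCT**: with `M_j = Σ_{x∈B} |c_x|(1+|x₀|+|x₁|)ʲ` and `G_j = Σ'_η [∃ i, L/4 < |ηᵢ|] ‖ĝ♭(η)‖(1+|η₀|+|η₁|)ʲ`,
`Σ'_ν [L/2 < |ν₀| ∨ L/2 < |ν₁|] ‖𝓕(g·P)♭(ν)‖·(|ν₀|+|ν₁|)ʲ ≤ M_j · G_j`. -/
theorem ztail_symbolFlat_mul_trigPoly_le (j : ℕ)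
    (hwg : Summable fun η : Fin 2 → ℤ => ‖mFourierCoeff (symbolFlat g hgper) η‖ * (1 + ∑ i : Fin 2, |((η i : ℤ) : ℝ)|) ^ j) :
    ∑' ν : Fin 2 → ℤ, (if (L / 2 < (ν 0).natAbs ∨ L / 2 < (ν 1).natAbs) then
        ‖mFourierCoeff (symbolFlat (fun q => g q * P q) (mul_trigPoly_periodic hgper B c hP)) ν‖ * (|((ν 0 : ℤ) : ℝ)| + |((ν 1 : ℤ) : ℝ)|) ^ j else 0) ≤
      (∑ x ∈ B, |c x| * (1 + |((x 0 : ℤ) : ℝ)| + |((x 1 : ℤ) : ℝ)|) ^ j) *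
        ∑' η : Fin 2 → ℤ, (if ∃ i, L / 4 < (η i).natAbs then
          ‖mFourierCoeff (symbolFlat g hgper) η‖ * (1 + ∑ i : Fin 2, |((η i : ℤ) : ℝ)|) ^ j else 0) := by
  classical
  obtain ⟨G, hGdef⟩ : ∃ G : (Fin 2 → ℤ) → ℝ, G = fun η => if ∃ i, L / 4 < (η i).natAbs then
      ‖mFourierCoeff (symbolFlat g hgper) η‖ * (1 + ∑ i : Fin 2, |((η i : ℤ) : ℝ)|) ^ j else 0 := ⟨_, rfl⟩
  have hG0 : ∀ η, 0 ≤ G η := fun η => by rw [hGdef]; simp only; split_ifs <;> positivity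
  have hGsum : Summable G := by
    refine Summable.of_nonneg_of_le hG0 (fun η => ?_) hwg
    rw [hGdef]; simp only; split_ifs
    · exact le_rfl
    · positivity
  have hGshift : ∀ y : Fin 2 → ℤ, Summable fun ν : Fin 2 → ℤ => G (ν + y) := fun y =>
    (Equiv.addRight y).summable_iff.2 hGsum
  have hGshift_eq : ∀ y : Fin 2 → ℤ, ∑' ν : Fin 2 → ℤ, G (ν + y) = ∑' η, G η := fun y => (Equiv.addRight y).tsum_eq G
  -- pointwise majorant
  obtain ⟨w, hwdef⟩ : ∃ w : (Fin 2 → ℤ) → ℝ, w = fun x => (1 + |((x 0 : ℤ) : ℝ)| + |((x 1 : ℤ) : ℝ)|) ^ j := ⟨_, rfl⟩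
  have hw0 : ∀ x, 0 ≤ w x := fun x => by rw [hwdef]; positivity
  have hpt : ∀ ν : Fin 2 → ℤ, (if (L / 2 < (ν 0).natAbs ∨ L / 2 < (ν 1).natAbs) then
        ‖mFourierCoeff (symbolFlat (fun q => g q * P q) (mul_trigPoly_periodic hgper B c hP)) ν‖ * (|((ν 0 : ℤ) : ℝ)| + |((ν 1 : ℤ) : ℝ)|) ^ j else 0) ≤
      ∑ x ∈ B, |c x| / 2 * w x * (G (ν + -x) + G (ν + x)) := by
    intro ν
    split_ifs with hν
    · calc ‖mFourierCoeff (symbolFlat (fun q => g q * P q) (mul_trigPoly_periodic hgper B c hP)) ν‖ * (|((ν 0 : ℤ) : ℝ)| + |((ν 1 : ℤ) : ℝ)|) ^ j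
          ≤ (∑ x ∈ B, (|c x| / 2) * (‖mFourierCoeff (symbolFlat g hgper) (ν - x)‖ + ‖mFourierCoeff (symbolFlat g hgper) (ν + x)‖)) *
              (|((ν 0 : ℤ) : ℝ)| + |((ν 1 : ℤ) : ℝ)|) ^ j :=
            mul_le_mul_of_nonneg_right (norm_mFourierCoeff_symbolFlat_mul_trigPoly_le hgper hg B c hP (mul_trigPoly_periodic hgper B c hP) ν) (by positivity)
        _ = ∑ x ∈ B, (|c x| / 2) * (‖mFourierCoeff (symbolFlat g hgper) (ν - x)‖ * (|((ν 0 : ℤ) : ℝ)| + |((ν 1 : ℤ) : ℝ)|) ^ j +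
              ‖mFourierCoeff (symbolFlat g hgper) (ν + x)‖ * (|((ν 0 : ℤ) : ℝ)| + |((ν 1 : ℤ) : ℝ)|) ^ j) := by
            rw [Finset.sum_mul]
            refine Finset.sum_congr rfl fun x _ => ?_
            ring
        _ ≤ ∑ x ∈ B, |c x| / 2 * w x * (G (ν + -x) + G (ν + x)) := by
            refine Finset.sum_le_sum fun x hx => ?_
            have hm : ‖mFourierCoeff (symbolFlat g hgper) (ν - x)‖ * (|((ν 0 : ℤ) : ℝ)| + |((ν 1 : ℤ) : ℝ)|) ^ j ≤ w x * G (ν - x) := by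
              rw [hGdef, hwdef]; exact shifted_term_sub_le hgper B hB hx hν j
            have hp : ‖mFourierCoeff (symbolFlat g hgper) (ν + x)‖ * (|((ν 0 : ℤ) : ℝ)| + |((ν 1 : ℤ) : ℝ)|) ^ j ≤ w x * G (ν + x) := by
              rw [hGdef, hwdef]; exact shifted_term_add_le hgper B hB hx hν j
            rw [← sub_eq_add_neg]
            calc |c x| / 2 * (‖mFourierCoeff (symbolFlat g hgper) (ν - x)‖ * (|((ν 0 : ℤ) : ℝ)| + |((ν 1 : ℤ) : ℝ)|) ^ j +
                  ‖mFourierCoeff (symbolFlat g hgper) (ν + x)‖ * (|((ν 0 : ℤ) : ℝ)| + |((ν 1 : ℤ) : ℝ)|) ^ j)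
                ≤ |c x| / 2 * (w x * G (ν - x) + w x * G (ν + x)) := mul_le_mul_of_nonneg_left (add_le_add hm hp) (by positivity)
              _ = |c x| / 2 * w x * (G (ν - x) + G (ν + x)) := by ring
    · exact Finset.sum_nonneg fun x _ => by
        have := hG0 (ν + -x); have := hG0 (ν + x); have := hw0 x; positivity
  -- sum the majorant
  have hmaj_sum : Summable fun ν : Fin 2 → ℤ => ∑ x ∈ B, |c x| / 2 * w x * (G (ν + -x) + G (ν + x)) :=
    summable_sum fun x _ => ((hGshift _).add (hGshift _)).mul_left _
  have hlhs_sum : Summable fun ν : Fin 2 → ℤ => (if (L / 2 < (ν 0).natAbs ∨ L / 2 < (ν 1).natAbs) then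
      ‖mFourierCoeff (symbolFlat (fun q => g q * P q) (mul_trigPoly_periodic hgper B c hP)) ν‖ * (|((ν 0 : ℤ) : ℝ)| + |((ν 1 : ℤ) : ℝ)|) ^ j else 0) :=
    Summable.of_nonneg_of_le (fun ν => by positivity) hpt hmaj_sum
  refine (Summable.tsum_le_tsum hpt hlhs_sum hmaj_sum).trans (le_of_eq ?_)
  rw [Summable.tsum_finsetSum (fun x _ => ((hGshift _).add (hGshift _)).mul_left _), Finset.sum_mul]
  refine Finset.sum_congr rfl fun x _ => ?_
  rw [tsum_mul_left, ((hGshift _)).tsum_add (hGshift _), hGshift_eq, hGshift_eq]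
  subst hGdef hwdef
  ring

omit hB in
/-- **Weighted summability of `𝓕(g·P)♭`** from that of `ĝ♭` (order `J`): the hypothesis of part 1's aliasing bound for the product. -/
theorem summable_weighted_symbolFlat_mul_trigPoly (J : ℕ)
    (hwg : Summable fun η : Fin 2 → ℤ => ‖mFourierCoeff (symbolFlat g hgper) η‖ * (1 + ∑ i : Fin 2, |((η i : ℤ) : ℝ)|) ^ J) :
    Summable fun ν : Fin 2 → ℤ => ‖mFourierCoeff (symbolFlat (fun q => g q * P q) (mul_trigPoly_periodic hgper B c hP)) ν‖ * (1 + ∑ i : Fin 2, |((ν i : ℤ) : ℝ)|) ^ J := by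
  classical
  obtain ⟨H, hHdef⟩ : ∃ H : (Fin 2 → ℤ) → ℝ, H = fun η => ‖mFourierCoeff (symbolFlat g hgper) η‖ * (1 + ∑ i : Fin 2, |((η i : ℤ) : ℝ)|) ^ J :=
    ⟨_, rfl⟩
  have hHshift : ∀ y : Fin 2 → ℤ, Summable fun ν : Fin 2 → ℤ => H (ν + y) := fun y => by
    rw [hHdef]; exact (Equiv.addRight y).summable_iff.2 hwg
  obtain ⟨w, hwdef⟩ : ∃ w : (Fin 2 → ℤ) → ℝ, w = fun x => (1 + |((x 0 : ℤ) : ℝ)| + |((x 1 : ℤ) : ℝ)|) ^ J := ⟨_, rfl⟩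
  have hw0 : ∀ x, 0 ≤ w x := fun x => by rw [hwdef]; positivity
  have hH0 : ∀ η, 0 ≤ H η := fun η => by rw [hHdef]; positivity
  have hww : ∀ ν y : Fin 2 → ℤ, (1 + ∑ i : Fin 2, |((ν i : ℤ) : ℝ)|) ^ J ≤ w y * (1 + ∑ i : Fin 2, |(((ν + y) i : ℤ) : ℝ)|) ^ J := by
    intro ν y
    rw [hwdef]
    simp only
    rw [← mul_pow]
    refine pow_le_pow_left₀ (by positivity) ?_ J
    simp only [Fin.sum_univ_two, Pi.add_apply, Int.cast_add]
    have h0 : |((ν 0 : ℤ) : ℝ)| ≤ |((ν 0 : ℤ) : ℝ) + ((y 0 : ℤ) : ℝ)| + |((y 0 : ℤ) : ℝ)| := by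
      have := abs_add_le (((ν 0 : ℤ) : ℝ) + ((y 0 : ℤ) : ℝ)) (-((y 0 : ℤ) : ℝ)); simp only [add_neg_cancel_right, abs_neg] at this; exact this
    have h1 : |((ν 1 : ℤ) : ℝ)| ≤ |((ν 1 : ℤ) : ℝ) + ((y 1 : ℤ) : ℝ)| + |((y 1 : ℤ) : ℝ)| := by
      have := abs_add_le (((ν 1 : ℤ) : ℝ) + ((y 1 : ℤ) : ℝ)) (-((y 1 : ℤ) : ℝ)); simp only [add_neg_cancel_right, abs_neg] at this; exact this
    nlinarith [abs_nonneg (((ν 0 : ℤ) : ℝ) + ((y 0 : ℤ) : ℝ)), abs_nonneg (((ν 1 : ℤ) : ℝ) + ((y 1 : ℤ) : ℝ)),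
      abs_nonneg ((y 0 : ℤ) : ℝ), abs_nonneg ((y 1 : ℤ) : ℝ),
      mul_nonneg (add_nonneg (abs_nonneg ((y 0 : ℤ) : ℝ)) (abs_nonneg ((y 1 : ℤ) : ℝ)))
        (add_nonneg (abs_nonneg (((ν 0 : ℤ) : ℝ) + ((y 0 : ℤ) : ℝ))) (abs_nonneg (((ν 1 : ℤ) : ℝ) + ((y 1 : ℤ) : ℝ))))]
  refine Summable.of_nonneg_of_le (fun ν => by positivity) (fun ν => ?_)
    (summable_sum (s := B) fun x _ => ((hHshift ((-1 : ℤ) • x)).add (hHshift ((1 : ℤ) • x))).mul_left (|c x| / 2 * w x))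
  calc ‖mFourierCoeff (symbolFlat (fun q => g q * P q) (mul_trigPoly_periodic hgper B c hP)) ν‖ * (1 + ∑ i : Fin 2, |((ν i : ℤ) : ℝ)|) ^ J
      ≤ (∑ x ∈ B, (|c x| / 2) * (‖mFourierCoeff (symbolFlat g hgper) (ν - x)‖ + ‖mFourierCoeff (symbolFlat g hgper) (ν + x)‖)) *
          (1 + ∑ i : Fin 2, |((ν i : ℤ) : ℝ)|) ^ J :=
        mul_le_mul_of_nonneg_right (norm_mFourierCoeff_symbolFlat_mul_trigPoly_le hgper hg B c hP (mul_trigPoly_periodic hgper B c hP) ν) (by positivity)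
    _ = ∑ x ∈ B, (|c x| / 2) * (‖mFourierCoeff (symbolFlat g hgper) (ν + (-1 : ℤ) • x)‖ * (1 + ∑ i : Fin 2, |((ν i : ℤ) : ℝ)|) ^ J +
          ‖mFourierCoeff (symbolFlat g hgper) (ν + (1 : ℤ) • x)‖ * (1 + ∑ i : Fin 2, |((ν i : ℤ) : ℝ)|) ^ J) := by
        rw [Finset.sum_mul]
        refine Finset.sum_congr rfl fun x _ => ?_
        rw [neg_one_zsmul, one_zsmul, ← sub_eq_add_neg]
        ring
    _ ≤ ∑ x ∈ B, |c x| / 2 * w x * (H (ν + (-1 : ℤ) • x) + H (ν + (1 : ℤ) • x)) := by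
        refine Finset.sum_le_sum fun x _ => ?_
        have hm : ‖mFourierCoeff (symbolFlat g hgper) (ν + (-1 : ℤ) • x)‖ * (1 + ∑ i : Fin 2, |((ν i : ℤ) : ℝ)|) ^ J ≤
            w ((-1 : ℤ) • x) * H (ν + (-1 : ℤ) • x) := by
          have := mul_le_mul_of_nonneg_left (hww ν ((-1 : ℤ) • x)) (norm_nonneg (mFourierCoeff (symbolFlat g hgper) (ν + (-1 : ℤ) • x)))
          refine this.trans (le_of_eq ?_)
          rw [hHdef]; ring
        have hp : ‖mFourierCoeff (symbolFlat g hgper) (ν + (1 : ℤ) • x)‖ * (1 + ∑ i : Fin 2, |((ν i : ℤ) : ℝ)|) ^ J ≤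
            w ((1 : ℤ) • x) * H (ν + (1 : ℤ) • x) := by
          have := mul_le_mul_of_nonneg_left (hww ν ((1 : ℤ) • x)) (norm_nonneg (mFourierCoeff (symbolFlat g hgper) (ν + (1 : ℤ) • x)))
          refine this.trans (le_of_eq ?_)
          rw [hHdef]; ring
        have hwx : w ((-1 : ℤ) • x) = w x := by
          rw [hwdef]; simp only [neg_one_zsmul, Pi.neg_apply, Int.cast_neg, abs_neg]
        have hwx' : w ((1 : ℤ) • x) = w x := by rw [hwdef]; simp only [one_zsmul]
        rw [hwx] at hm; rw [hwx'] at hp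
        calc |c x| / 2 * (‖mFourierCoeff (symbolFlat g hgper) (ν + (-1 : ℤ) • x)‖ * (1 + ∑ i : Fin 2, |((ν i : ℤ) : ℝ)|) ^ J +
              ‖mFourierCoeff (symbolFlat g hgper) (ν + (1 : ℤ) • x)‖ * (1 + ∑ i : Fin 2, |((ν i : ℤ) : ℝ)|) ^ J)
            ≤ |c x| / 2 * (w x * H (ν + (-1 : ℤ) • x) + w x * H (ν + (1 : ℤ) • x)) := mul_le_mul_of_nonneg_left (add_le_add hm hp) (by positivity)
          _ = |c x| / 2 * w x * (H (ν + (-1 : ℤ) • x) + H (ν + (1 : ℤ) • x)) := by ring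

end Tail

end Summit.HubbardSuperconductivity.HubbardSuperconductivity.Theorems.C4a

end
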